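/-
Copyright (c) 2026. All rights reserved.
Released under Apache 2.0 license as described in the file LICENSE.
Authors: abc-iut cell, S-chain team seat abc-iut-s2-p12 (gen 7; D-0079 R-W lane U «U2-LATTICE-INTEGERS»), over
abc-iut-c312-3's `UnitLogInnerRadiusTie*` and abc-iut-w6-d060's `UnitLogBoundaryRamification*` / `UnitLogKernel`.
-/
import Mathlib.GroupTheory.SpecificGroups.Cyclic
import Mathlib.FieldTheory.Finite.Basic
import Literature.IUT.LogVolume.UnitLogInnerRadiusTieRoots
import Literature.IUT.LogVolume.UnitLogKernel
import HarnessLib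

/-!
# The inner radius at a TIE index `e = A·(p−1)`, III: `ζ_p ∈ K` and `p ∣ A` ALLOWED — the torsion-witness
# criterion `{‖z‖ ≤ ‖ϖ‖^A} ⊆ log_p(𝒪_K^×) ⟺ some root of unity of `K` that is not a `p`-th power in `K`
# is a `p`-th power modulo `p·𝔪_K^A`

Proof-only file (theorems, no definitions, no named fact), sequel of abc-iut-c312-3's
`UnitLogInnerRadiusTie.lean` / `UnitLogInnerRadiusTieRoots.lean` (the level-`A` congruence
`L(1 + ϖ^A a) ≡ ϖ^A·(a + c·a^p) (mod 𝔪^{A+1})`, `c = ϖ^e/p`; the lift «unit zero of `ā ↦ ā + c̄·ā^p` ↔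
`ζ_p ∈ K`»; `ζ_p ∉ K ⇒ r_in = A` and the gap at `A − 1`, both for `p ∤ A`).  HERE the remaining case of the
D-0079 R-W lane-U table: `ζ_p ∈ K`, with NO hypothesis `p ∤ A` — so the Kummer layers `e = l(l−1)`,
`2l(l−1)` over `p = l` of the cell's genuine completions `K_w ⊇ ℚ_l(ζ_l)` are covered.  Setting: `K` a proper
ultrametric normed `ℚ_p`-algebra field (a finite extension of `ℚ_p`), `p` ODD, `ϖ` a norm uniformizer,
`e = absRamificationIdx p K = A·(p−1)` (`A ≥ 1` arbitrary), `Λ := log_p(𝒪_K^×) = logUnits K`,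
`U^{(t)} := {‖1 − y‖ ≤ ‖ϖ‖ᵗ}`.

THE POINT (classical; Serre, *Local Fields* XIV §4 for the filtration of `K^×/(K^×)^p`; Neukirch ANT II
(5.5)–(5.7)).  Always `𝔪^{A+1} ⊆ Λ` (`closedBall_div_succ_subset_logUnits`), and `log_p(U^{(A)})` is, modulo
`𝔪^{A+1}`, the image of the additive residue polynomial `P(ā) = ā + c̄·ā^p`; when `ζ_p ∈ K` that image has
index `p` in the residue field.  Whether the WHOLE critical ball `𝔪^A` lies in `Λ` is then decided by the
units of LOWER level whose logarithm lands in `𝔪^A`: `log_p u ∈ 𝔪^A ⟺ log_p(u^p) ∈ 𝔪^{A+e} = L(U^{(A+e)})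
⟺ u^p ∈ μ(K)·U^{(A+e)}`.  Hence (§2–§4):

  **`𝔪^A ⊆ Λ ⟺ ∃ ζ' ∈ μ(K), ∃ u ∈ K : ζ' ∉ K^p and ‖u^p − ζ'‖ ≤ ‖p‖·‖ϖ‖^A`** (`‖p‖·‖ϖ‖^A = ‖ϖ‖^{A·p}`),

i.e. some root of unity which is not a `p`-th power in `K` becomes one modulo `U^{(A+e)}` — equivalently
(classical reformulation, not typed here) `K(μ_{p^{m+1}})/K` is UNRAMIFIED of degree `p`, `p^m = #μ_{p^∞}(K)`.
Consequences: `r_in ∈ {A, A+1}` at every tie index; the witness can only exist when `p ∣ A` (for `p ∤ A`,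
`ζ_p ∈ K` gives `r_in = A + 1`: abc-iut-c312-3's Part III, not restated here); for `K = ℚ_p(ζ_{p²})`
(`A = p`) there is no witness (`K(ζ_{p³})/K` is ramified), so `r_in = p + 1`.

* §0 a finite-field lemma (`exists_addPoly_add_intCast_mul_eq`): over a finite field `k` of characteristic
  `p`, if `b₀` is NOT a value of `P(x) = x + γ·x^p` then every `b ∈ k` is `P(a) + j·b₀` (`j ∈ ℤ`): `ker P`
  has at most `p` elements (roots of a non-zero polynomial of degree `≤ p`), so `k/P(k)` has prime order `p`
  (`#(k/P(k)) = #ker P` divides `#k = p^f`, and is `≠ 1`) and is generated by the class of `b₀`.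
* §1 levels of `p`-th powers at `e = A(p−1)` (any `A`): `(U^{(A)})^p ⊆ U^{(A+e)}`
  (`norm_one_add_pow_prime_sub_one_le_prime_mul`); below the critical level the `p`-th power map is EXACT,
  `‖(1+x)^p − 1‖ = ‖x‖^p` for `‖ϖ‖^A < ‖x‖ ≤ 1` (`norm_one_add_pow_prime_sub_one_eq`); torsion inside
  `U^{(A+1)}` is trivial; a non-trivial `p`-th root of unity has level EXACTLY `A`
  (`norm_one_sub_eq_pow_level_of_pow_prime_eq_one`, no `p ∤ A` needed) and yields a unit zero of `P`.
* §2 **⟹** (`exists_torsionWitness_of_closedBall_level_subset_logUnits`): if `ζ_p ∈ K` and `𝔪^A ⊆ Λ`, pick a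
  NON-VALUE `b` of `P` (`P` has a non-zero zero, so is not onto the finite residue field); `ϖ^A b = log_p u₀`;
  for the principal power `u = u₀^m` (`p ∤ m`), `log_p(u^p) = L(w)` with `w ∈ U^{(A+e)}`, `ζ' := u^p/w` has
  `log_p ζ' = 0`, so is a ROOT OF UNITY (abc-iut-w6's `unitLog_eq_zero_iff`); were `ζ' = η^p`, `v := u/η`
  would be a principal unit with `v^p = w ∈ U^{(A+e)}`, forcing `v ∈ U^{(A)}` (exactness below level `A`),
  and then the congruence makes `m·b` — hence `b` — a value of `P`: contradiction.
* §3 **⟸** (`closedBall_level_subset_logUnits_of_torsionWitness`): given the witness, `z₀ := log_p u ∈ 𝔪^A`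
  and `z₀/ϖ^A` is a NON-VALUE of `P` (else `u = ρ·y·v` with `y ∈ U^{(A)}`, `v ∈ U^{(A+1)}`, `ρ` torsion, and
  `ρ^p = ζ'·w'` with `w' ∈ U^{(A+e)}`, `L(w') = 0`, so `w' = 1` and `ζ' = ρ^p`); by §0 every residue is
  `P(ā) + j·(z₀/ϖ^A)‾`, so every `z ∈ 𝔪^A` is `L(1 + ϖ^A a) + j·z₀` up to `𝔪^{A+1} ⊆ Λ`.
* §4 the criterion as an `iff` (`closedBall_level_subset_logUnits_iff_torsionWitness`) and the R-W format:
  **no witness ⇒ `r_in = A + 1`** (`innerRadius_tie_succ_of_forall_not_torsionWitness`: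
  `closedBall 0 ‖ϖ‖^{A+1} ⊆ logUnits K ∧ ¬ closedBall 0 ‖ϖ‖^A ⊆ logUnits K`).

References: [cite: NeukirchANT1999, Ch. II Prop. (5.5)–(5.7)] [cite: SerreLocalFields1979, Ch. XIV §4]
[cite: Washington1997, Lemma 1.4, §5.1].  Classical; `logUnits` is the cell's typing of [IUTchIV] Prop. 1.2's
`log_p(R^×)` ([claim: Mochizuki2012, status: disputed] for that locution only).  Consumer (record only):
D-0079 R-W lane U column «rho_in» at the tie places with `p ∣ A` (layers `e = l(l−1)`, `2l(l−1)` at `p = l`).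
Nothing here is disputed mathematics; no IUT statement is asserted; nothing bears on [IUTchIII] Cor. 3.12.
-/

noncomputable section

open Metric Set IsUltrametricDist IsLocalRing
open scoped NormedField

namespace Literature.IUT.LogVolume

open Literature.NumberTheory.GaloisRepresentations.Ultrametric BoundaryRamification

namespace LogEnvelope

/-! ### §0. A finite-field lemma: the range of `x ↦ x + γ·x^p` has index `≤ p` -/

section FiniteField

variable (p : ℕ) [hp : Fact p.Prime] {k : Type*} [Field k] [Finite k] [CharP k p]

/-- **Over a finite field `k` of characteristic `p`: if `b₀` is not a value of the additive polynomial
`P(x) = x + γ·x^p`, then every `b ∈ k` is `P(a) + j·b₀` for some `a ∈ k`, `j ∈ ℤ`.**  (`#ker P ≤ p` as the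
kernel consists of roots of a non-zero polynomial of degree `≤ p`; `#(k/P(k)) = #ker P` divides `#k = p^f`
and is not `1`, so `k/P(k)` has prime order `p` and is generated by the class of `b₀`.)
[cite: Washington1997, §5.1] [cite: SerreLocalFields1979, Ch. XIV §4] -/
theorem exists_addPoly_add_intCast_mul_eq (γ b₀ : k) (hb₀ : ∀ a : k, a + γ * a ^ p ≠ b₀) (b : k) :
    ∃ (a : k) (j : ℤ), a + γ * a ^ p + (j : k) * b₀ = b := by
  classical
  haveI := Fintype.ofFinite k
  -- the additive endomorphism `P` and its range `H`
  let P : k →+ k :=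
    { toFun := fun x => x + γ * x ^ p
      map_zero' := by simp [zero_pow hp.out.ne_zero]
      map_add' := fun x y => addPoly_add p γ x y }
  have hP : ∀ x, P x = x + γ * x ^ p := fun _ => rfl
  set H : AddSubgroup k := P.range with hH
  -- `#k = #H · #ker P` and `#k = #(k ⧸ H) · #H`, so `#(k ⧸ H) = #ker P`
  have hcardK : Nat.card k = Nat.card H * Nat.card P.ker := by
    rw [AddSubgroup.card_eq_card_quotient_mul_card_addSubgroup P.ker,
      Nat.card_congr (QuotientAddGroup.quotientKerEquivRange P).toEquiv]
  have hcardK' : Nat.card k = Nat.card (k ⧸ H) * Nat.card H :=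
    AddSubgroup.card_eq_card_quotient_mul_card_addSubgroup H
  have hH0 : 0 < Nat.card H := Nat.card_pos
  have hQ : Nat.card (k ⧸ H) = Nat.card P.ker := by
    have h := hcardK.symm.trans hcardK'
    rw [mul_comm (Nat.card (k ⧸ H))] at h
    exact (Nat.eq_of_mul_eq_mul_left hH0 h).symm
  -- `#ker P ≤ p`
  have hker_le : Nat.card P.ker ≤ p := by
    set f : Polynomial k := Polynomial.X + Polynomial.C γ * Polynomial.X ^ p with hf
    have hf0 : f ≠ 0 := by
      intro h
      have h1 := congrArg (fun g : Polynomial k => g.coeff 1) h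
      simp only [hf, Polynomial.coeff_add, Polynomial.coeff_X_one, Polynomial.coeff_C_mul,
        Polynomial.coeff_X_pow, Polynomial.coeff_zero] at h1
      rw [if_neg hp.out.one_lt.ne] at h1
      simp at h1
    have hdeg : f.natDegree ≤ p := by
      refine (Polynomial.natDegree_add_le _ _).trans (max_le ?_ ?_)
      · exact Polynomial.natDegree_X_le.trans hp.out.one_lt.le
      · exact (Polynomial.natDegree_C_mul_le _ _).trans (Polynomial.natDegree_X_pow p).le
    have hmem : ∀ x : P.ker, (x : k) ∈ f.roots.toFinset := by
      intro x
      rw [Multiset.mem_toFinset, Polynomial.mem_roots hf0, Polynomial.IsRoot.def]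
      have hx : P x = 0 := x.2
      rw [hP] at hx
      simp only [hf, Polynomial.eval_add, Polynomial.eval_X, Polynomial.eval_mul, Polynomial.eval_C,
        Polynomial.eval_pow]
      exact hx
    have hinj : Function.Injective fun x : P.ker => (⟨(x : k), hmem x⟩ : f.roots.toFinset) := by
      intro x y hxy
      have h := congrArg Subtype.val hxy
      exact Subtype.ext h
    calc Nat.card P.ker ≤ Nat.card f.roots.toFinset := Nat.card_le_card_of_injective _ hinj
      _ = f.roots.toFinset.card := by rw [Nat.card_eq_fintype_card, Fintype.card_coe]
      _ ≤ Multiset.card f.roots := Multiset.toFinset_card_le _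
      _ ≤ f.natDegree := Polynomial.card_roots' f
      _ ≤ p := hdeg
  -- `b₀ ∉ H`, so `k ⧸ H` is non-trivial; its order divides `#k = p^n` and is `≤ p`: it is `p`
  have hb₀H : b₀ ∉ H := by
    rintro ⟨a, ha⟩
    exact hb₀ a (by rw [← hP]; exact ha)
  have hmk0 : (QuotientAddGroup.mk b₀ : k ⧸ H) ≠ 0 := by
    rwa [Ne, QuotientAddGroup.eq_zero_iff]
  obtain ⟨n, -, hn⟩ := FiniteField.card k p
  have hdvd : Nat.card (k ⧸ H) ∣ p ^ (n : ℕ) := by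
    rw [← hn, ← Nat.card_eq_fintype_card]
    exact AddSubgroup.card_quotient_dvd_card H
  obtain ⟨i, -, hcard⟩ := (Nat.dvd_prime_pow hp.out).mp hdvd
  have hi0 : i ≠ 0 := by
    rintro rfl
    rw [pow_zero] at hcard
    haveI := (Nat.card_eq_one_iff_unique.mp hcard).1
    exact hmk0 (Subsingleton.elim _ _)
  have hcardp : Nat.card (k ⧸ H) = p :=
    le_antisymm (hQ ▸ hker_le) (hcard ▸ Nat.le_self_pow hi0 p)
  -- a group of prime order is generated by any non-zero element
  have hgen : AddSubgroup.zmultiples (QuotientAddGroup.mk b₀ : k ⧸ H) = ⊤ :=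
    zmultiples_eq_top_of_prime_card hcardp hmk0
  have hmemb : (QuotientAddGroup.mk b : k ⧸ H) ∈ AddSubgroup.zmultiples (QuotientAddGroup.mk b₀ : k ⧸ H) := by
    rw [hgen]; exact AddSubgroup.mem_top _
  obtain ⟨j, hj⟩ := AddSubgroup.mem_zmultiples_iff.mp hmemb
  have hdiff : b - (j : k) * b₀ ∈ H := by
    rw [← QuotientAddGroup.eq_zero_iff, ← zsmul_eq_mul]
    have h : (QuotientAddGroup.mk (b - j • b₀) : k ⧸ H) =
        QuotientAddGroup.mk b - j • QuotientAddGroup.mk b₀ := by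
      rw [← QuotientAddGroup.mk'_apply, map_sub, map_zsmul]; rfl
    rw [h, hj, sub_self]
  obtain ⟨a, ha⟩ := hdiff
  refine ⟨a, j, ?_⟩
  rw [← hP, ha, sub_add_cancel]

end FiniteField

/-! ### §1. Levels of `p`-th powers and of roots of unity at `e = A·(p−1)` (any `A`) -/

section Field

variable (p : ℕ) [hp : Fact p.Prime]
variable {K : Type*} [NontriviallyNormedField K] [instK : NormedAlgebra ℚ_[p] K] [IsUltrametricDist K]
  [ProperSpace K]
variable {ϖ : Kˣ} (hϖ : IsUniformizer ϖ) {A : ℕ} (hA : absRamificationIdx p K = A * (p - 1))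
include hϖ hA

/-- `‖p‖·‖ϖ‖^A = ‖ϖ‖^{A·p}` (`‖p‖ = ‖ϖ‖^e`, `e + A = A·p`): the radius of `U^{(A+e)} = (U^{(A)})^p·U^{(A+e+1)}`.
[cite: NeukirchANT1999, Ch. II (5.5)] -/
theorem norm_prime_mul_pow_level : ‖(p : K)‖ * ‖(ϖ : K)‖ ^ A = ‖(ϖ : K)‖ ^ (A * p) := by
  rw [norm_prime_eq_norm_pow p K hϖ, hA, ← pow_add]
  congr 1
  rw [Nat.mul_sub_one, Nat.sub_add_cancel (Nat.le_mul_of_pos_right A hp.out.pos)]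

/-- `‖p‖·‖ϖ‖^A ≤ ‖ϖ‖^{A+1}` (`A·p ≥ A + 1`). [cite: NeukirchANT1999, Ch. II (5.5)] -/
theorem norm_prime_mul_pow_level_le : ‖(p : K)‖ * ‖(ϖ : K)‖ ^ A ≤ ‖(ϖ : K)‖ ^ (A + 1) := by
  rw [norm_prime_mul_pow_level p hϖ hA]
  have hA1 := one_le_level p hA
  have hp2 := hp.out.two_le
  exact pow_le_pow_of_le_one (norm_nonneg _) hϖ.1.le (by nlinarith)

/-- `‖p‖·‖ϖ‖^A·p^{1/(p−1)} < 1`: the ball of radius `‖p‖·‖ϖ‖^A` is inside the isometry range of `log_p`.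
[cite: NeukirchANT1999, Ch. II (5.5)] -/
theorem prime_mul_pow_level_mul_rpow_lt_one :
    ‖(p : K)‖ * ‖(ϖ : K)‖ ^ A * (p : ℝ) ^ (1 / ((p : ℝ) - 1)) < 1 :=
  lt_of_le_of_lt (mul_le_mul_of_nonneg_right (norm_prime_mul_pow_level_le p hϖ hA)
    (Real.rpow_nonneg (Nat.cast_nonneg _) _)) (pow_level_succ_mul_rpow_lt_one p hϖ hA)

/-- `‖p‖·‖ϖ‖^A < 1`. [cite: NeukirchANT1999, Ch. II (5.5)] -/
theorem norm_prime_mul_pow_level_lt_one : ‖(p : K)‖ * ‖(ϖ : K)‖ ^ A < 1 :=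
  (norm_prime_mul_pow_level_le p hϖ hA).trans_lt (pow_lt_one₀ (norm_nonneg _) hϖ.1 (by omega))

/-- **`(U^{(A)})^p ⊆ U^{(A+e)}`**: for `‖x‖ ≤ ‖ϖ‖^A`, `‖(1+x)^p − 1‖ ≤ ‖p‖·‖ϖ‖^A` (in `𝒪`,
`(x+1)^p = x^p + 1 + p·x·r`; `‖x^p‖ ≤ ‖ϖ‖^{A·p} = ‖p‖·‖ϖ‖^A` and `‖p·x·r‖ ≤ ‖p‖·‖ϖ‖^A`).
[cite: NeukirchANT1999, Ch. II Prop. (5.5)] [cite: SerreLocalFields1979, Ch. XIV §4] -/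
theorem norm_one_add_pow_prime_sub_one_le_prime_mul {x : K} (hx : ‖x‖ ≤ ‖(ϖ : K)‖ ^ A) :
    ‖(1 + x) ^ p - 1‖ ≤ ‖(p : K)‖ * ‖(ϖ : K)‖ ^ A := by
  have hρ0 : 0 < ‖(ϖ : K)‖ := norm_units_pos ϖ
  have hx1 : ‖x‖ ≤ 1 := hx.trans (pow_le_one₀ hρ0.le hϖ.1.le)
  let X : Valued.integer K := ⟨x, Valued.integer.mem_iff.mpr hx1⟩
  obtain ⟨R, hR⟩ := exists_add_pow_prime_eq hp.out X 1
  have hRn : ‖(R : K)‖ ≤ 1 := Valued.integer.norm_le_one R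
  have hK : (x + 1) ^ p = x ^ p + 1 + (p : K) * x * R := by
    have h := congrArg (fun z : Valued.integer K => (z : K)) hR
    simpa [X] using h
  have hrew : (1 + x) ^ p - 1 = x ^ p + (p : K) * x * R := by
    rw [add_comm, hK]; ring
  rw [hrew]
  refine (norm_add_le_max _ _).trans (max_le ?_ ?_)
  · rw [norm_pow, norm_prime_mul_pow_level p hϖ hA, pow_mul]
    exact pow_le_pow_left₀ (norm_nonneg _) hx p
  · rw [norm_mul, norm_mul]
    calc ‖(p : K)‖ * ‖x‖ * ‖(R : K)‖ ≤ ‖(p : K)‖ * ‖(ϖ : K)‖ ^ A * 1 := by gcongr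
      _ = ‖(p : K)‖ * ‖(ϖ : K)‖ ^ A := mul_one _

/-- **Below the critical level the `p`-th power map is exact**: for `‖ϖ‖^A < ‖x‖ ≤ 1`,
`‖(1+x)^p − 1‖ = ‖x‖^p` (`‖p·x·r‖ ≤ ‖ϖ‖^{A(p−1)}·‖x‖ < ‖x‖^{p−1}·‖x‖`).
[cite: NeukirchANT1999, Ch. II Prop. (5.5)] [cite: SerreLocalFields1979, Ch. XIV §4] -/
theorem norm_one_add_pow_prime_sub_one_eq {x : K} (hxA : ‖(ϖ : K)‖ ^ A < ‖x‖) (hx1 : ‖x‖ ≤ 1) :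
    ‖(1 + x) ^ p - 1‖ = ‖x‖ ^ p := by
  have hρ0 : 0 < ‖(ϖ : K)‖ := norm_units_pos ϖ
  let X : Valued.integer K := ⟨x, Valued.integer.mem_iff.mpr hx1⟩
  obtain ⟨R, hR⟩ := exists_add_pow_prime_eq hp.out X 1
  have hRn : ‖(R : K)‖ ≤ 1 := Valued.integer.norm_le_one R
  have hK : (x + 1) ^ p = x ^ p + 1 + (p : K) * x * R := by
    have h := congrArg (fun z : Valued.integer K => (z : K)) hR
    simpa [X] using h
  have hrew : (1 + x) ^ p - 1 = x ^ p + (p : K) * x * R := by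
    rw [add_comm, hK]; ring
  rw [hrew]
  have hx0 : 0 < ‖x‖ := lt_of_le_of_lt (pow_nonneg hρ0.le _) hxA
  have hp1 : p - 1 ≠ 0 := by have := hp.out.two_le; omega
  have hlt : ‖(p : K) * x * R‖ < ‖x ^ p‖ := by
    rw [norm_mul, norm_mul, norm_pow, norm_prime_eq_norm_pow p K hϖ, hA]
    have key : ‖(ϖ : K)‖ ^ (A * (p - 1)) < ‖x‖ ^ (p - 1) := by
      rw [pow_mul]; exact pow_lt_pow_left₀ hxA (pow_nonneg hρ0.le _) hp1
    calc ‖(ϖ : K)‖ ^ (A * (p - 1)) * ‖x‖ * ‖(R : K)‖ ≤ ‖(ϖ : K)‖ ^ (A * (p - 1)) * ‖x‖ * 1 := by gcongr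
      _ < ‖x‖ ^ (p - 1) * ‖x‖ := by rw [mul_one]; exact mul_lt_mul_of_pos_right key hx0
      _ = ‖x‖ ^ p := by rw [← pow_succ, Nat.sub_add_cancel hp.out.one_lt.le]
  rw [norm_add_eq_max_of_norm_ne_norm (ne_of_gt hlt), max_eq_left hlt.le, norm_pow]

/-- **Torsion inside `U^{(A+1)}` is trivial**: `ζ^n = 1` (`n ≥ 1`) and `‖1 − ζ‖ ≤ ‖ϖ‖^{A+1}` force `ζ = 1`
(`L(ζ) = 0 = L(1)` and `L` is injective on `U^{(A+1)}`). [cite: NeukirchANT1999, Ch. II Prop. (5.5)] -/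
theorem eq_one_of_pow_eq_one_of_norm_one_sub_le {ζ : K} {n : ℕ} (hn : 0 < n) (hζ : ζ ^ n = 1)
    (h : ‖1 - ζ‖ ≤ ‖(ϖ : K)‖ ^ (A + 1)) : ζ = 1 := by
  have hρ0 : 0 < ‖(ϖ : K)‖ := norm_units_pos ϖ
  have hζP : IsPrincipal ζ := by
    show ‖1 - ζ‖ < 1
    exact lt_of_le_of_lt h (pow_lt_one₀ hρ0.le hϖ.1 (by omega))
  have hL : logSeries ζ = 0 := by
    rw [← unitLog_of_isPrincipal p hζP]; exact unitLog_eq_zero_of_pow_eq_one p hn hζ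
  have h1 : ‖(1 : K) - 1‖ ≤ ‖(ϖ : K)‖ ^ (A + 1) := by
    rw [sub_self, norm_zero]; exact pow_nonneg hρ0.le _
  refine logSeries_injOn p K (pow_level_succ_mul_rpow_lt_one p hϖ hA) h h1 ?_
  rw [hL, logSeries_one]

/-- **A non-trivial `p`-th root of unity has level EXACTLY `A = e/(p−1)`** (ANY `A`, `p ∣ A` allowed): below
level `A` the `p`-th power map is exact (`(1+x)^p ≠ 1`), above it torsion is trivial.
[cite: NeukirchANT1999, Ch. II Prop. (5.5), (7.13)] [cite: Washington1997, Lemma 1.4] -/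
theorem norm_one_sub_eq_pow_level_of_pow_prime_eq_one {ζ : K} (hζ : ζ ^ p = 1) (hζ1 : ζ ≠ 1) :
    ‖1 - ζ‖ = ‖(ϖ : K)‖ ^ A := by
  have hρ0 : 0 < ‖(ϖ : K)‖ := norm_units_pos ϖ
  have hζP := isPrincipal_of_pow_prime_eq_one p hζ
  have hx : (1 : K) - ζ ≠ 0 := sub_ne_zero.mpr (Ne.symm hζ1)
  obtain ⟨s, hs⟩ := hϖ.2 (Units.mk0 (1 - ζ) hx)
  rw [Units.val_mk0] at hs
  rcases lt_trichotomy s (A : ℤ) with hlt | heq | hgt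
  · exfalso
    have hxA : ‖(ϖ : K)‖ ^ A < ‖ζ - 1‖ := by
      rw [norm_sub_rev, hs, ← zpow_natCast]
      exact zpow_lt_zpow_right_of_lt_one₀ hρ0 hϖ.1 hlt
    have h := norm_one_add_pow_prime_sub_one_eq p hϖ hA hxA (by rw [norm_sub_rev]; exact hζP.le)
    rw [add_sub_cancel, hζ, sub_self, norm_zero] at h
    have hx0 : 0 < ‖ζ - 1‖ := norm_pos_iff.mpr (sub_ne_zero.mpr hζ1)
    exact (ne_of_gt (pow_pos hx0 p)) h.symm
  · rw [hs, heq, zpow_natCast]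
  · exfalso
    have hle : ‖1 - ζ‖ ≤ ‖(ϖ : K)‖ ^ (A + 1) := by
      rw [hs, ← zpow_natCast]
      exact zpow_le_zpow_right_of_le_one₀ hρ0 hϖ.1.le (by push_cast; omega)
    exact hζ1 (eq_one_of_pow_eq_one_of_norm_one_sub_le p hϖ hA hp.out.pos hζ hle)

/-- **A non-trivial `p`-th root of unity yields a UNIT zero `a₁ = (ζ − 1)/ϖ^A` of the residue polynomial**
(ANY `A`): `‖a₁‖ = 1`, `1 + ϖ^A a₁ = ζ`, `‖a₁ + c·a₁^p‖ < 1` (the level-`A` congruence with `L(ζ) = 0`).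
[cite: Washington1997, §5.1] [cite: NeukirchANT1999, Ch. II (5.7)] -/
theorem exists_unit_zero_of_pow_prime_eq_one_anyLevel (hp2 : p ≠ 2) {ζ : K} (hζ : ζ ^ p = 1)
    (hζ1 : ζ ≠ 1) :
    ∃ a : K, ‖a‖ = 1 ∧ 1 + (ϖ : K) ^ A * a = ζ ∧
      ‖a + (ϖ : K) ^ absRamificationIdx p K / (p : K) * a ^ p‖ < 1 := by
  have hρ0 : 0 < ‖(ϖ : K)‖ := norm_units_pos ϖ
  have hϖA0 : (ϖ : K) ^ A ≠ 0 := pow_ne_zero _ ϖ.ne_zero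
  have hL := logSeries_eq_zero_of_pow_prime_eq_one p hζ
  have hn := norm_one_sub_eq_pow_level_of_pow_prime_eq_one p hϖ hA hζ hζ1
  have ha1 : ‖(ζ - 1) / (ϖ : K) ^ A‖ = 1 := by
    rw [norm_div, ← norm_neg, neg_sub, hn, norm_pow, div_self (pow_ne_zero _ hρ0.ne')]
  refine ⟨(ζ - 1) / (ϖ : K) ^ A, ha1, ?_, ?_⟩
  · field_simp
    ring
  · have hcong := norm_logSeries_sub_le_level p hϖ hA hp2 ha1.le
    rw [mul_div_cancel₀ _ hϖA0, add_sub_cancel, hL, zero_sub, norm_neg, norm_mul, norm_pow,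
      pow_succ] at hcong
    have h := le_of_mul_le_mul_left hcong (pow_pos hρ0 _)
    exact h.trans_lt hϖ.1

omit hϖ hA in
omit [ProperSpace K] in
/-- `U_r := {‖1 − t‖ ≤ r}` (`r < 1`) is closed under products. [cite: NeukirchANT1999, Ch. II (3.10)] -/
theorem norm_one_sub_mul_le_of_le {r : ℝ} (hr : r < 1) {s t : K} (hs : ‖1 - s‖ ≤ r) (ht : ‖1 - t‖ ≤ r) :
    ‖1 - s * t‖ ≤ r := by
  have hsP : IsPrincipal s := by
    show ‖1 - s‖ < 1
    exact lt_of_le_of_lt hs hr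
  have hs1 : ‖s‖ = 1 := hsP.norm_eq_one
  have h : (1 : K) - s * t = (1 - s) + s * (1 - t) := by ring
  rw [h]
  refine (norm_add_le_max _ _).trans (max_le hs ?_)
  rw [norm_mul, hs1, one_mul]; exact ht

omit hϖ hA in
omit [ProperSpace K] in
/-- `U_r := {‖1 − t‖ ≤ r}` (`r < 1`) is closed under inverses. [cite: NeukirchANT1999, Ch. II (3.10)] -/
theorem norm_one_sub_inv_le_of_le {r : ℝ} (hr : r < 1) {s : K} (hs : ‖1 - s‖ ≤ r) : ‖1 - s⁻¹‖ ≤ r := by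
  have hsP : IsPrincipal s := by
    show ‖1 - s‖ < 1
    exact lt_of_le_of_lt hs hr
  have hs1 : ‖s‖ = 1 := hsP.norm_eq_one
  have hs0 : s ≠ 0 := norm_pos_iff.mp (by rw [hs1]; exact one_pos)
  have h : (1 : K) - s⁻¹ = s⁻¹ * (s - 1) := by rw [mul_sub, inv_mul_cancel₀ hs0, mul_one]
  rw [h, norm_mul, norm_inv, hs1, inv_one, one_mul, norm_sub_rev]; exact hs

end Field

end LogEnvelope

end Literature.IUT.LogVolume

end
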